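import Summits.NavierStokesRegularity.Statement
import Literature.Analysis.FluidPDE.ClassicalSolution
import Literature.Analysis.FluidPDE.LerayHopf
import Literature.Analysis.FluidPDE.SuitableWeak
import HarnessLib

/-!
# Route TypeICertificateLadder — ladder Assembly, route-independent statement
(item stmt-NavierStokesRegularity-13893)

Summits-side theorem file for the restated assembly item (rank 1) of route `TypeICertificateLadder`
of `NavierStokesRegularity` (Clay (A)):

`(∀ C > 0, X_C) → LadderGlue → NoTypeII → NoBlowupToClay → NavierStokesRegularity`.

It imports NO route (`Theses`) file: the four route Props `LadderGlue`, `NoTypeIBlowup` (inside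
`LadderGlue`), `NoTypeII` and `NoBlowupToClay` of
`Summits/NavierStokesRegularity/NavierStokesRegularity/Theses/TypeICertificateLadder.lean` are written
out verbatim, so that the theorem below is *definitionally* the route decl
`Summit.NavierStokesRegularity.NavierStokesRegularity.Theses.TypeICertificateLadder.Assembly` and the
gate's `Assembly_holds` link can import this module into the route file without an import cycle
(route-repair landing note on stmt-NavierStokesRegularity-13893, 2026-08-15; same pattern as
`Theorems/NoBlowupToClay.lean` and `Theorems/BlowupAssembly.lean`).

Dictionary of the hypotheses, in order:

* `hR` — every rung `X_C`, `C > 0`: a classical solution of unforced Navier–Stokes on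
  `ℝ³ × [0, T)` which is Leray–Hopf from its rapidly decaying datum and has the eventual
  dimensionless rate `√(T−t) ‖u(t,x)‖ ≤ C √ν` extends smoothly past `T`;
* `hLG` — `LadderGlue`: all rungs imply `NoTypeIBlowup` (no Type-I blow-up for Clay data);
* `hII` — `NoTypeII`: a maximal smooth solution (classical on `[0, T)`, no smooth extension past
  `T`) which is Leray–Hopf from a rapidly decaying datum blows up at most at the Type-I rate;
* `hClay` — `NoBlowupToClay`: "every such solution extends past every `T`" implies Clay (A).

Proof (pure logic, the route's deciding theorem `closes` composed with `LadderGlue`): `hLG hR` is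
`NoTypeIBlowup`; given `hClay` it suffices to extend an arbitrary classical Leray–Hopf
rapidly-decaying-datum solution past `T`; if it did not extend it would be maximal
(`IsMaximalSmoothSolution` := classical on `Ico 0 T` ∧ ¬ `HasSmoothExtensionPast`), hence Type I
by `hII`, hence it extends by `NoTypeIBlowup` — contradiction.
-/

namespace Summit.NavierStokesRegularity.NavierStokesRegularity.Theorems

open scoped Topology
open Filter Set

/-- **Ladder assembly of route TypeICertificateLadder** (item stmt-NavierStokesRegularity-13893),
stated without importing the route file (the route Props are unfolded verbatim; this type is
definitionally `Summit.NavierStokesRegularity.NavierStokesRegularity.Theses.TypeICertificateLadder.Assembly`):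
every rung `X_C` (`C > 0`), together with `LadderGlue` (all rungs ⇒ no Type-I blow-up), `NoTypeII`
(maximal solutions blow up at most at the Type-I rate) and `NoBlowupToClay` (no blow-up ⇒ Clay (A)),
gives `NavierStokesRegularity`. Proof: `LadderGlue` applied to the rungs is `NoTypeIBlowup`; a
non-extending classical Leray–Hopf rapidly-decaying-datum solution is maximal, hence Type I by
`NoTypeII`, hence extends by `NoTypeIBlowup`, a contradiction; `NoBlowupToClay` concludes. -/
theorem typeICertificateLadder_ladderAssembly :
    (∀ C : ℝ, 0 < C → ∀ (ν T : ℝ), 0 < ν → 0 < T →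
      ∀ (u : ℝ → EuclideanSpace ℝ (Fin 3) → EuclideanSpace ℝ (Fin 3))
        (p : ℝ → EuclideanSpace ℝ (Fin 3) → ℝ),
        Literature.Analysis.FluidPDE.IsClassicalNSSolutionOn (Set.Ico 0 T) ν 0 u p →
        Literature.Analysis.FluidPDE.IsLerayHopfOn T ν 0 (u 0) u →
        Literature.Analysis.FluidPDE.HasRapidSpatialDecay (u 0) →
        (∀ᶠ t in 𝓝[<] T, ∀ x, Real.sqrt (T - t) * ‖u t x‖ ≤ C * Real.sqrt ν) →
        Literature.Analysis.FluidPDE.HasSmoothExtensionPast ν 0 u T) →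
    -- `LadderGlue` := (∀ C > 0, X_C) → `NoTypeIBlowup`
    ((∀ C : ℝ, 0 < C → ∀ (ν T : ℝ), 0 < ν → 0 < T →
        ∀ (u : ℝ → EuclideanSpace ℝ (Fin 3) → EuclideanSpace ℝ (Fin 3))
          (p : ℝ → EuclideanSpace ℝ (Fin 3) → ℝ),
          Literature.Analysis.FluidPDE.IsClassicalNSSolutionOn (Set.Ico 0 T) ν 0 u p →
          Literature.Analysis.FluidPDE.IsLerayHopfOn T ν 0 (u 0) u →
          Literature.Analysis.FluidPDE.HasRapidSpatialDecay (u 0) →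
          (∀ᶠ t in 𝓝[<] T, ∀ x, Real.sqrt (T - t) * ‖u t x‖ ≤ C * Real.sqrt ν) →
          Literature.Analysis.FluidPDE.HasSmoothExtensionPast ν 0 u T) →
      -- `NoTypeIBlowup`
      ∀ (ν T : ℝ), 0 < ν → 0 < T →
        ∀ (u : ℝ → EuclideanSpace ℝ (Fin 3) → EuclideanSpace ℝ (Fin 3))
          (p : ℝ → EuclideanSpace ℝ (Fin 3) → ℝ),
          Literature.Analysis.FluidPDE.IsClassicalNSSolutionOn (Set.Ico 0 T) ν 0 u p →
          Literature.Analysis.FluidPDE.IsLerayHopfOn T ν 0 (u 0) u →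
          Literature.Analysis.FluidPDE.HasRapidSpatialDecay (u 0) →
          Literature.Analysis.FluidPDE.IsTypeIBlowup u T →
          Literature.Analysis.FluidPDE.HasSmoothExtensionPast ν 0 u T) →
    -- `NoTypeII`
    (∀ (ν T : ℝ), 0 < ν → 0 < T →
      ∀ (u : ℝ → EuclideanSpace ℝ (Fin 3) → EuclideanSpace ℝ (Fin 3))
        (p : ℝ → EuclideanSpace ℝ (Fin 3) → ℝ),
        Literature.Analysis.FluidPDE.IsMaximalSmoothSolution ν 0 u p T →
        Literature.Analysis.FluidPDE.IsLerayHopfOn T ν 0 (u 0) u →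
        Literature.Analysis.FluidPDE.HasRapidSpatialDecay (u 0) →
        Literature.Analysis.FluidPDE.IsTypeIBlowup u T) →
    -- `NoBlowupToClay`
    ((∀ (ν T : ℝ), 0 < ν → 0 < T →
        ∀ (u : ℝ → EuclideanSpace ℝ (Fin 3) → EuclideanSpace ℝ (Fin 3))
          (p : ℝ → EuclideanSpace ℝ (Fin 3) → ℝ),
          Literature.Analysis.FluidPDE.IsClassicalNSSolutionOn (Set.Ico 0 T) ν 0 u p →
          Literature.Analysis.FluidPDE.IsLerayHopfOn T ν 0 (u 0) u →
          Literature.Analysis.FluidPDE.HasRapidSpatialDecay (u 0) →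
          Literature.Analysis.FluidPDE.HasSmoothExtensionPast ν 0 u T) →
      NavierStokesRegularity) →
    NavierStokesRegularity := by
  intro hR hLG hII hClay
  apply hClay
  intro ν T hν hT u p hcl hLH hdec
  by_contra hext
  exact hext (hLG hR ν T hν hT u p hcl hLH hdec (hII ν T hν hT u p ⟨hcl, hext⟩ hLH hdec))

end Summit.NavierStokesRegularity.NavierStokesRegularity.Theorems
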